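import Summits.CriticalPhenomena.PercolationContinuityZ3.Theorems.SahiCISCylinderConverse
import Summits.CriticalPhenomena.PercolationContinuityZ3.Theorems.SahiCISAtomic

/-!
# The corrected Definition 4: WEAK comparability `A ≤ B` instead of strict separation

Cell `prim-sahi`, typer (generation 17); `--supports stmt-CriticalPhenomena-4575`.  No named facts, no sorries.

Colangelo–Müller–Scarsini's Definition 4 compares conditioning sets `A < B` that are STRICTLY separated in every
coordinate, and is therefore blind to conditioning points sharing a coordinate (`SahiCISDefinitionFour.lean`).  The
natural repair replaces `A < B` by POINTWISE WEAK COMPARABILITY: `a ≤ b` for all `a ∈ A`, `b ∈ B` (measurable `A, B`,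
not only boxes).  For the last coordinate of a law on `Q_{d+1}` this is `CondIncrLastLE` below; at every level,
`IsCIScylLE`.

* `condIncrLastLE_of_aepairMonoKernel`, **`IsCISae.condIncrLastLE`**, **`IsCISae.isCIScylLE`** — the corrected condition
  is NECESSARY for CIS in the a.e.-kernel sense, for every law (Tonelli on `A × B`).
* `CondIncrLastLE.condIncrLast` (it contains the strictly-separated-box condition (c)) and
  **`CondIncrLastLE.condIncrAtom`** (singletons `{a} ≤ {b}`: it contains the classical atom condition) — so it is
  SUFFICIENT for `IsCISae` on laws with atomless one-dimensional marginals (`isCISae_iff_isCIScylLE_of_noAtoms`) and on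
  finitely supported laws (`isCISae_iff_isCIScylLE_of_finite_support`), and on `Q_2` (`isCISae_two_iff_condIncrLastLE`);
  the example `cmsExample` of `SahiCISDefinitionFour.lean` (Definition-4-CIS, not associated) fails it.
  (Sufficiency for ALL laws — mixed atomic/diffuse conditioning marginals — is the subject of the sequel.)

References: Colangelo–Müller–Scarsini 2006, Def. 4, Thm. 4 [ColangeloMullerScarsini2006].  Statements are this work.
-/

noncomputable section

namespace Summit.CriticalPhenomena.PercolationContinuityZ3.Theorems.SahiCIS

open MeasureTheory ProbabilityTheory Set Filter Topology Function
open Summit.CriticalPhenomena.PercolationContinuityZ3.Theorems.SahiBoxTP2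
open scoped ENNReal unitInterval

variable {d : ℕ}

/-- **The corrected Definition 4 for the last coordinate** of a law `μ` on `Q_{d+1}`: for all measurable
`A, B ⊆ Q_d` with `a ≤ b` for every `a ∈ A`, `b ∈ B`, and every measurable upper `V ⊆ [0,1]`,
`µ(x' ∈ A, x_d ∈ V) µ(x' ∈ B) ≤ µ(x' ∈ B, x_d ∈ V) µ(x' ∈ A)`. [this work] -/
def CondIncrLastLE (μ : Measure (Fin (d + 1) → I)) : Prop :=
  ∀ ⦃A B : Set (Fin d → I)⦄, MeasurableSet A → MeasurableSet B → (∀ a ∈ A, ∀ b ∈ B, a ≤ b) →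
    ∀ ⦃V : Set I⦄, IsUpperSet V → MeasurableSet V →
      μ.map initLast (A ×ˢ V) * (μ.map initLast).fst B ≤ μ.map initLast (B ×ˢ V) * (μ.map initLast).fst A

/-- **The corrected Definition 4 at every level**, by recursion on the dimension. [this work] -/
def IsCIScylLE : (d : ℕ) → Measure (Fin d → I) → Prop
  | 0, _ => True
  | d + 1, μ => IsCIScylLE d (μ.map initLast).fst ∧ CondIncrLastLE μ

/-! ### Necessity -/

/-- **A disintegration kernel stochastically increasing on almost every pair gives the corrected condition** (Tonelli
on `A × B`, all of whose points are comparable pairs). [this work] -/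
theorem condIncrLastLE_of_aepairMonoKernel (μ : Measure (Fin (d + 1) → I)) [IsProbabilityMeasure μ]
    (κ : Kernel (Fin d → I) I) [IsMarkovKernel κ] (hdis : (μ.map initLast).fst ⊗ₘ κ = μ.map initLast)
    (hmono : AEPairMonoKernel (μ.map initLast).fst κ) : CondIncrLastLE μ := by
  intro A B hAm hBm hAB V hV hVm
  set ν := (μ.map initLast).fst with hν
  haveI : IsProbabilityMeasure ν := by rw [hν]; infer_instance
  have hκV : Measurable fun x : Fin d → I => κ x V := κ.measurable_coe hVm
  rw [← hdis, Measure.compProd_apply_prod hAm hVm, Measure.compProd_apply_prod hBm hVm]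
  have hleft : (∫⁻ x in A, κ x V ∂ν) * ν B = ∫⁻ p in A ×ˢ B, κ p.1 V ∂(ν.prod ν) := by
    rw [← Measure.prod_restrict,
      lintegral_prod (fun p : (Fin d → I) × (Fin d → I) => κ p.1 V) (hκV.comp measurable_fst).aemeasurable]
    simp only [lintegral_const, Measure.restrict_apply MeasurableSet.univ, univ_inter]
    rw [lintegral_mul_const _ hκV]
  have hright : (∫⁻ x in B, κ x V ∂ν) * ν A = ∫⁻ p in A ×ˢ B, κ p.2 V ∂(ν.prod ν) := by
    rw [← Measure.prod_restrict,
      lintegral_prod (fun p : (Fin d → I) × (Fin d → I) => κ p.2 V) (hκV.comp measurable_snd).aemeasurable]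
    simp only [lintegral_const, Measure.restrict_apply MeasurableSet.univ, univ_inter]
  rw [hleft, hright]
  refine lintegral_mono_ae ((ae_restrict_iff' (hAm.prod hBm)).2 ?_)
  filter_upwards [hmono] with p hp hpAB
  exact measure_upperSet_le_of_Iic_le (κ p.1) (κ p.2) (hp (hAB p.1 hpAB.1 p.2 hpAB.2)) hV hVm

/-- **`IsCISae (d+1)` implies the corrected condition for the last coordinate.** [this work] -/
theorem IsCISae.condIncrLastLE (μ : Measure (Fin (d + 1) → I)) [IsProbabilityMeasure μ] (hμ : IsCISae (d + 1) μ) :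
    CondIncrLastLE μ := by
  obtain ⟨-, κ, hκ, hdis, hmono⟩ := hμ
  exact condIncrLastLE_of_aepairMonoKernel μ κ hdis hmono

/-- **`IsCISae d` implies the corrected condition at every level.** [this work] -/
theorem IsCISae.isCIScylLE : ∀ (d : ℕ) (μ : Measure (Fin d → I)) [IsProbabilityMeasure μ], IsCISae d μ → IsCIScylLE d μ := by
  intro d
  induction d with
  | zero => intro μ _ _; trivial
  | succ d ih => intro μ _ hμ; exact ⟨ih _ hμ.1, hμ.condIncrLastLE μ⟩

/-! ### The corrected condition contains condition (c) and the atom condition -/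

/-- The corrected condition contains the strictly-separated-box condition (c). [this work] -/
theorem CondIncrLastLE.condIncrLast {μ : Measure (Fin (d + 1) → I)} (h : CondIncrLastLE μ) : CondIncrLast μ :=
  fun _ _ _ _ hsep _ hV hVm => h measurableSet_Icc measurableSet_Icc
    (fun _ hx _ hy i => (hx.2 i).trans ((le_of_lt (hsep i)).trans (hy.1 i))) hV hVm

/-- The corrected condition contains the classical atom condition (singletons `{a} ≤ {b}`, passing from the upper
set `(x,1]` to its complement `[0,x]`). [this work] -/
theorem CondIncrLastLE.condIncrAtom {μ : Measure (Fin (d + 1) → I)} [IsFiniteMeasure μ] (h : CondIncrLastLE μ) :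
    CondIncrAtom μ := by
  intro a b hab x
  haveI : IsFiniteMeasure (μ.map initLast) := Measure.isFiniteMeasure_map μ _
  set ρ := μ.map initLast with hρ
  have hU : IsUpperSet (Ioi x) := isUpperSet_Ioi x
  have key := h (measurableSet_singleton a) (measurableSet_singleton b)
    (fun u hu v hv => by rw [mem_singleton_iff.1 hu, mem_singleton_iff.1 hv]; exact hab) hU measurableSet_Ioi
  -- `ρ.fst {c} = ρ({c} × (x,1]) + ρ({c} × [0,x])`
  have hsplit : ∀ c : Fin d → I, ρ.fst {c} = ρ ({c} ×ˢ Ioi x) + ρ ({c} ×ˢ Iic x) := fun c => by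
    rw [fst_eq_add_prod_compl' ρ (measurableSet_singleton c) (measurableSet_Ioi (a := x)), compl_Ioi]
  rw [hsplit b, hsplit a, mul_add, mul_add, mul_comm (ρ ({b} ×ˢ Ioi x)) (ρ ({a} ×ˢ Ioi x))] at key
  have hfin : ρ ({a} ×ˢ Ioi x) * ρ ({b} ×ˢ Ioi x) ≠ ⊤ := ENNReal.mul_ne_top (measure_ne_top _ _) (measure_ne_top _ _)
  have key' := (ENNReal.add_le_add_iff_left hfin).1 key
  -- `key' : ρ({a} × (x,1]) ρ({b} × [0,x]) ≤ ρ({b} × (x,1]) ρ({a} × [0,x])`; add `ρ({a} × [0,x]) ρ({b} × [0,x])`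
  calc ρ ({b} ×ˢ Iic x) * ρ.fst {a}
      = ρ ({a} ×ˢ Ioi x) * ρ ({b} ×ˢ Iic x) + ρ ({a} ×ˢ Iic x) * ρ ({b} ×ˢ Iic x) := by rw [hsplit a]; ring
    _ ≤ ρ ({b} ×ˢ Ioi x) * ρ ({a} ×ˢ Iic x) + ρ ({a} ×ˢ Iic x) * ρ ({b} ×ˢ Iic x) := add_le_add key' le_rfl
    _ = ρ ({a} ×ˢ Iic x) * ρ.fst {b} := by rw [hsplit b]; ring

/-- At every level: the corrected condition contains `IsCIScyl` and `IsCISatom`. [this work] -/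
theorem IsCIScylLE.isCIScyl_and_isCISatom :
    ∀ (d : ℕ) (μ : Measure (Fin d → I)) [IsFiniteMeasure μ], IsCIScylLE d μ → IsCIScyl d μ ∧ IsCISatom d μ := by
  intro d
  induction d with
  | zero => intro μ _ _; exact ⟨trivial, trivial⟩
  | succ d ih =>
    rintro μ _ ⟨h1, h2⟩
    obtain ⟨ha, hb⟩ := ih _ h1
    exact ⟨⟨ha, h2.condIncrLast⟩, ⟨hb, h2.condIncrAtom⟩⟩

/-! ### Sufficiency in the two resolved classes -/

/-- **Atomless one-dimensional marginals: the corrected condition ⟺ CIS (a.e.-kernel sense).** [this work] -/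
theorem isCISae_iff_isCIScylLE_of_noAtoms (μ : Measure (Fin d → I)) [IsProbabilityMeasure μ]
    (hna : ∀ (i : Fin d) (x : I), μ {z | z i = x} = 0) : IsCISae d μ ↔ IsCIScylLE d μ :=
  ⟨IsCISae.isCIScylLE d μ, fun h => IsCIScyl.isCISae_of_noAtoms d μ (IsCIScylLE.isCIScyl_and_isCISatom d μ h).1 hna⟩

/-- **Finite support: the corrected condition ⟺ CIS (a.e.-kernel sense).** [this work] -/
theorem isCISae_iff_isCIScylLE_of_finite_support (μ : Measure (Fin d → I)) [IsProbabilityMeasure μ]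
    (hD : ∃ D : Finset (Fin d → I), μ (↑D)ᶜ = 0) : IsCISae d μ ↔ IsCIScylLE d μ :=
  ⟨IsCISae.isCIScylLE d μ, fun h =>
    isCISae_of_isCISatom_of_finite_support d μ hD (IsCIScylLE.isCIScyl_and_isCISatom d μ h).2⟩

/-- **Dimension 2: the corrected condition ⟺ CIS**, no hypothesis. [this work] -/
theorem isCISae_two_iff_condIncrLastLE (μ : Measure (Fin 2 → I)) [IsProbabilityMeasure μ] :
    IsCISae 2 μ ↔ CondIncrLastLE μ :=
  ⟨fun h => h.condIncrLastLE μ, fun h => isCISae_two_of_condIncrLast μ h.condIncrLast⟩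

end Summit.CriticalPhenomena.PercolationContinuityZ3.Theorems.SahiCIS

end
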